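import Mathlib
import HarnessLib

/-!
# A pushforward by a homeomorphism (or a bi-Lipschitz map) has support homeomorphic to the
# support of the base law; no bi-Lipschitz map transports a law EXACTLY onto one whose support is
# not homeomorphic (Cornish–Caterini–Deligiannidis–Doucet 2020, §2 condition (2) and Theorem 2.1 in
# the exact-transport case; Supplement Props. B.3, B.4, B.6)

Setting [cite: CornishEtAl2020, §2].  A "pushforward density estimator" is `P_X := f # P_Z` for a
prior `P_Z` on `𝒵` and a map `f : 𝒵 → 𝒳`; a normalising flow takes `f` bijective with `f`, `f⁻¹`
continuous, i.e. a homeomorphism.  `supp μ` is the (closed) topological support — the points all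
of whose open neighbourhoods have positive mass — which is Mathlib's `MeasureTheory.Measure.support`
(`Mathlib/MeasureTheory/Measure/Support.lean`; Props. B.1/B.2 of the Supplement are Mathlib's
`Measure.AbsolutelyContinuous.support_mono`, `Measure.isClosed_support`,
`Measure.compl_support_eq_sUnion`).  The bi-Lipschitz constant `BiLip f ∈ [1, ∞]` is the infimum of
the `M` with `M⁻¹ ‖z − z'‖ ≤ ‖f z − f z'‖ ≤ M ‖z − z'‖` [cite: CornishEtAl2020, §2 eq. (3);
Supplement §B.2], i.e. of the `M` with `LipschitzWith M f ∧ AntilipschitzWith M f` (the typing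
already used by `BiLipschitzObstruction.lean` in this directory).

Results (all PROVED; Mathlib only):

* `support_map_eq_closure_image` — **Prop. B.3** [cite: CornishEtAl2020, Supplement Prop. B.3]:
  for a continuous `f` and a Borel measure `μ` with `μ((supp μ)ᶜ) = 0`,
  `supp (f # μ) = closure (f (supp μ))`; the two inclusions are `image_support_subset_support_map`
  (needs only continuity) and `support_map_subset_closure_image` (needs only `μ((supp μ)ᶜ) = 0`).
  The side condition holds on every separable metric space — **Prop. B.4**
  [cite: CornishEtAl2020, Supplement Prop. B.4] — which is Mathlib's `Measure.measure_compl_support`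
  for hereditarily Lindelöf spaces (`support_map_eq_closure_image'` is the instance form).
* `support_map_eq_image_of_isClosedEmbedding`, `nonempty_homeomorph_support_map` — for a CLOSED
  EMBEDDING `f` (a homeomorphism; or a bi-Lipschitz map out of a complete space, **Prop. B.6**
  [cite: CornishEtAl2020, Supplement Prop. B.6] = Mathlib's `AntilipschitzWith.isClosedEmbedding`):
  `supp (f # μ) = f (supp μ)` and `supp μ ≅ supp (f # μ)`.
* `nonempty_homeomorph_support_of_map_eq` — **condition (2)** [cite: CornishEtAl2020, §2 eq. (2)]:
  "`supp P_X = supp P_X⋆` only if `supp P_Z ≅ supp P_X⋆`" — if a homeomorphism `f` has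
  `f # P_Z = P_X⋆` then the supports are homeomorphic.
* `map_ne_of_isEmpty_homeomorph_support` and, verbatim on `ℝ^{d_𝒵} → ℝ^{d_𝒳}`,
  **`CornishEtAl2020_thm_2_1_exact`** — **Theorem 2.1 in the exact-transport case**
  [cite: CornishEtAl2020, Thm 2.1] (the constant sequence `f_n = f`, for which
  `f_n # P_Z ⇒ P_X⋆` reads `f # P_Z = P_X⋆`): if `supp P_Z ≇ supp P_X⋆` and `f # P_Z = P_X⋆` then
  `BiLip f = ∞`, i.e. NO `M` is simultaneously a Lipschitz and an antilipschitz constant of `f`.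
  This is the form in which the venture `LatticeQCDFlow` (cell pub-lqcd) cites the theorem
  ("infinite [bi-Lipschitz constant] for disjoint supports", `Scaling/Barriers.lean`).

Typing notes.  (i) "`𝒜 ≅ ℬ`" (homeomorphic) is `Nonempty (𝒜 ≃ₜ ℬ)` between the support subtypes,
and "`≇`" is `IsEmpty (𝒜 ≃ₜ ℬ)`.  (ii) "`BiLip f = ∞`" is `∀ M, ¬ (LipschitzWith M f ∧
AntilipschitzWith M f)`.  (iii) The general statements are over (extended) metric / topological
spaces with their Borel σ-algebras; the paper's `ℝ^d` is `EuclideanSpace ℝ (Fin d)`.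
(iv) The printed proof of Theorem 2.1 goes through Arzelà–Ascoli for a SEQUENCE `f_n`; in the
exact case typed here no limit map is needed and the proof is B.3 + B.4 + B.6 directly, exactly as
in the last paragraph of the printed proof [cite: CornishEtAl2020, Supplement §B.3].

Deliberately NOT here: the sequential statement of Theorem 2.1 (`f_n # P_Z ⇒ P_X⋆` weakly forces
`BiLip f_n → ∞`) and Corollary 2.2 (its `ε`-version for a weak metric `ρ`) — they are the subject
of the companion file `TopologicalSupportObstructionSequential.lean`; Props. B.5/B.7/Cor. B.8
(`BiLip` via injectivity / Jacobian operator norms) — Mathlib's `AntilipschitzWith.injective`,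
`LipschitzWith` API; §3–§4 of the paper (continuously indexed flows).
-/

namespace Literature.Probability.TransportMaps

open _root_.MeasureTheory Set Filter Topology
open scoped _root_.Topology NNReal ENNReal

variable {Z X : Type*}

/-! ## Prop. B.3: the support of a pushforward under a continuous map -/

section Support

variable [TopologicalSpace Z] [MeasurableSpace Z] [TopologicalSpace X] [MeasurableSpace X]
  [OpensMeasurableSpace X]

/-- **Prop. B.3, inclusion `⊇`** [cite: CornishEtAl2020, Supplement Prop. B.3 (second half of the
proof)]: for a continuous (measurable) `f`, `f (supp μ) ⊆ supp (f # μ)` — if `x = f z` with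
`z ∈ supp μ` and `N` is an open neighbourhood of `x`, then `f⁻¹ N` is an open neighbourhood of `z`,
so `(f # μ)(N) = μ(f⁻¹ N) > 0`.  No hypothesis on `μ` is needed for this half. -/
theorem image_support_subset_support_map {μ : Measure Z} {f : Z → X}
    (hf : Continuous f) (hfm : Measurable f) : f '' μ.support ⊆ (μ.map f).support := by
  rintro x ⟨z, hz, rfl⟩
  rw [(nhds_basis_opens (f z)).mem_measureSupport]
  rintro U ⟨hxU, hU⟩
  rw [Measure.map_apply hfm hU.measurableSet]
  exact (Measure.mem_support_iff_forall z).1 hz _ ((hU.preimage hf).mem_nhds hxU)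

/-- **Prop. B.3, inclusion `⊇` with the closure** [cite: CornishEtAl2020, Supplement Prop. B.3]:
`closure (f (supp μ)) ⊆ supp (f # μ)`, since the support is closed (Prop. B.2 = Mathlib's
`Measure.isClosed_support`). -/
theorem closure_image_support_subset_support_map {μ : Measure Z} {f : Z → X}
    (hf : Continuous f) (hfm : Measurable f) :
    closure (f '' μ.support) ⊆ (μ.map f).support :=
  closure_minimal (image_support_subset_support_map hf hfm) Measure.isClosed_support

/-- **Prop. B.3, inclusion `⊆`** [cite: CornishEtAl2020, Supplement Prop. B.3 (first half of the
proof)]: if `μ((supp μ)ᶜ) = 0` then `supp (f # μ) ⊆ closure (f (supp μ))` — a point outside the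
closure has an open neighbourhood `N` disjoint from `f (supp μ)`, so `f⁻¹ N ⊆ (supp μ)ᶜ` is
`μ`-null and `(f # μ)(N) = 0`.  (This half needs measurability of `f` only.) -/
theorem support_map_subset_closure_image {μ : Measure Z} (hμ : μ μ.supportᶜ = 0) {f : Z → X}
    (hfm : Measurable f) : (μ.map f).support ⊆ closure (f '' μ.support) := by
  intro x hx
  by_contra hxc
  have hopen : IsOpen (closure (f '' μ.support))ᶜ := isClosed_closure.isOpen_compl
  have hpos := (Measure.mem_support_iff_forall x).1 hx _ (hopen.mem_nhds hxc)
  rw [Measure.map_apply hfm hopen.measurableSet] at hpos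
  have hnull : μ (f ⁻¹' (closure (f '' μ.support))ᶜ) = 0 :=
    measure_mono_null (fun z hz hzS => hz (subset_closure ⟨z, hzS, rfl⟩)) hμ
  exact hpos.ne' hnull

/-- **Prop. B.3** [cite: CornishEtAl2020, Supplement Prop. B.3]: "Suppose `𝒵` and `𝒳` are
topological spaces.  If `μ` is a Borel measure on `𝒵` such that `μ((supp μ)ᶜ) = 0`, and if
`f : 𝒵 → 𝒳` is continuous, then `supp f#μ = closure (f(supp μ))`."  (As the paper notes, the
closure cannot be dropped — `μ` Gaussian, `f = arctan` — and the side condition cannot be dropped in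
general.) -/
theorem support_map_eq_closure_image {μ : Measure Z} (hμ : μ μ.supportᶜ = 0) {f : Z → X}
    (hf : Continuous f) (hfm : Measurable f) :
    (μ.map f).support = closure (f '' μ.support) :=
  (support_map_subset_closure_image hμ hfm).antisymm
    (closure_image_support_subset_support_map hf hfm)

/-- **Prop. B.3 with Prop. B.4** [cite: CornishEtAl2020, Supplement Props. B.3–B.4]: on a
hereditarily Lindelöf space (every separable metric space is one — Prop. B.4, Mathlib's
`Measure.measure_compl_support`) the side condition `μ((supp μ)ᶜ) = 0` is automatic, so
`supp (f # μ) = closure (f (supp μ))` for every continuous `f`. -/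
theorem support_map_eq_closure_image' [HereditarilyLindelofSpace Z] {μ : Measure Z} {f : Z → X}
    (hf : Continuous f) (hfm : Measurable f) :
    (μ.map f).support = closure (f '' μ.support) :=
  support_map_eq_closure_image Measure.measure_compl_support hf hfm

/-! ## Closed embeddings (homeomorphisms; bi-Lipschitz maps, Prop. B.6): `supp (f # μ) = f (supp μ)` -/

/-- For a CLOSED EMBEDDING `f` (e.g. a homeomorphism, or a bi-Lipschitz map on a complete space by
Prop. B.6) the closure in Prop. B.3 is superfluous: `supp (f # μ) = f (supp μ)`
[cite: CornishEtAl2020, §2 (footnote to condition (2)); Supplement §B.3 (last display of the proof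
of Thm 2.1: "`supp P_X⋆ = f_∞(supp P_Z)`")]. -/
theorem support_map_eq_image_of_isClosedEmbedding {μ : Measure Z} (hμ : μ μ.supportᶜ = 0)
    {f : Z → X} (hf : IsClosedEmbedding f) (hfm : Measurable f) :
    (μ.map f).support = f '' μ.support := by
  rw [support_map_eq_closure_image hμ hf.continuous hfm,
    (hf.isClosedMap _ Measure.isClosed_support).closure_eq]

/-- A closed embedding restricts to a HOMEOMORPHISM `supp μ ≅ supp (f # μ)`
[cite: CornishEtAl2020, Supplement §B.3 (end of the proof of Thm 2.1: "`supp P_Z ≅ f_∞(supp P_Z)`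
… `= supp P_X⋆`")]. -/
theorem nonempty_homeomorph_support_map {μ : Measure Z} (hμ : μ μ.supportᶜ = 0)
    {f : Z → X} (hf : IsClosedEmbedding f) (hfm : Measurable f) :
    Nonempty (μ.support ≃ₜ (μ.map f).support) :=
  ⟨(hf.isEmbedding.homeomorphImage μ.support).trans
    (Homeomorph.setCongr (support_map_eq_image_of_isClosedEmbedding hμ hf hfm).symm)⟩

end Support

/-! ## Condition (2): a flow can be exact only between laws with homeomorphic supports -/

section Homeomorph

variable [TopologicalSpace Z] [MeasurableSpace Z] [OpensMeasurableSpace Z]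
  [TopologicalSpace X] [MeasurableSpace X] [BorelSpace X]

/-- For a homeomorphism `f`, `supp (f # μ) = f (supp μ)` [cite: CornishEtAl2020, §2 eq. (1) with
its footnote ("`closure(f(supp P_Z)) = f(supp P_Z)` here since `supp P_Z` is closed")], under the
side condition `μ((supp μ)ᶜ) = 0` of Prop. B.3. -/
theorem support_map_homeomorph {μ : Measure Z} (hμ : μ μ.supportᶜ = 0) (f : Z ≃ₜ X) :
    (μ.map f).support = f '' μ.support :=
  support_map_eq_image_of_isClosedEmbedding hμ f.isClosedEmbedding f.measurable

/-- **Condition (2)** [cite: CornishEtAl2020, §2 eq. (2)]: "`supp P_X = supp P_X⋆` only if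
`supp P_Z ≅ supp P_X⋆`" for the flow model `P_X = f # P_Z`, `f` a homeomorphism — in particular an
EXACT flow, `f # P_Z = P_X⋆`, exists only between laws with homeomorphic supports ("normalising
flows are unable to exactly model targets whose topology differs from that of the prior",
[cite: CornishEtAl2020, §6]).  Side condition `P_Z((supp P_Z)ᶜ) = 0` as in Prop. B.3 (automatic on
separable metric spaces, Prop. B.4). -/
theorem nonempty_homeomorph_support_of_map_eq {μ : Measure Z} (hμ : μ μ.supportᶜ = 0)
    {ν : Measure X} (f : Z ≃ₜ X) (h : μ.map f = ν) :
    Nonempty (μ.support ≃ₜ ν.support) := by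
  subst h
  exact nonempty_homeomorph_support_map hμ f.isClosedEmbedding f.measurable

end Homeomorph

/-! ## Theorem 2.1 in the exact-transport case: `BiLip f = ∞` -/

section BiLipschitz

variable [EMetricSpace Z] [CompleteSpace Z] [MeasurableSpace Z] [BorelSpace Z]
  [EMetricSpace X] [MeasurableSpace X] [BorelSpace X]

omit [MeasurableSpace Z] [BorelSpace Z] [MeasurableSpace X] [BorelSpace X] in
/-- **Prop. B.6** [cite: CornishEtAl2020, Supplement Prop. B.6] in Mathlib's words: a map with a
finite bi-Lipschitz constant out of a complete space is a closed embedding (it is injective with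
Lipschitz inverse — Prop. B.5 — and maps closed sets to closed sets).  This is Mathlib's
`AntilipschitzWith.isClosedEmbedding`. -/
theorem isClosedEmbedding_of_biLipschitz {f : Z → X} {M : ℝ≥0}
    (hl : LipschitzWith M f) (ha : AntilipschitzWith M f) : IsClosedEmbedding f :=
  ha.isClosedEmbedding hl.uniformContinuous

/-- **Theorem 2.1, exact-transport case, general form** [cite: CornishEtAl2020, Thm 2.1 (with the
constant sequence `f_n = f`); Supplement §B.3]: over a complete separable (extended) metric space
`𝒵` and an (extended) metric space `𝒳`, if `supp μ ≇ supp ν` then NO map `f` with a finite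
bi-Lipschitz constant has `f # μ = ν`.  Proof as printed: such an `f` is a closed embedding
(Props. B.5–B.6), so `supp (f # μ) = f (supp μ) ≅ supp μ` (Props. B.3–B.4). -/
theorem map_ne_of_isEmpty_homeomorph_support [SecondCountableTopology Z]
    {μ : Measure Z} {ν : Measure X} (h : IsEmpty (μ.support ≃ₜ ν.support))
    {f : Z → X} {M : ℝ≥0} (hl : LipschitzWith M f) (ha : AntilipschitzWith M f) :
    μ.map f ≠ ν := by
  intro hfμ
  have hce : IsClosedEmbedding f := isClosedEmbedding_of_biLipschitz hl ha
  obtain ⟨e⟩ := nonempty_homeomorph_support_map (μ := μ) Measure.measure_compl_support hce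
    hl.continuous.measurable
  rw [hfμ] at e
  exact h.false e

/-- **Theorem 2.1 (Cornish–Caterini–Deligiannidis–Doucet), exact-transport case, as printed on
`ℝ^{d_𝒵} → ℝ^{d_𝒳}`** [cite: CornishEtAl2020, Thm 2.1]: "Suppose `P_Z` and `P_X⋆` are probability
measures on `ℝ^{d_𝒵}` and `ℝ^{d_𝒳}` respectively, and that `supp P_Z ≇ supp P_X⋆`.  Then for any
sequence of measurable `f_n : ℝ^{d_𝒵} → ℝ^{d_𝒳}`, we can have `f_n # P_Z ⇒ P_X⋆` only if
`lim_{n→∞} BiLip f_n = ∞`."  Specialised to the constant sequence `f_n = f` (for which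
`f_n # P_Z ⇒ P_X⋆` is `f # P_Z = P_X⋆`): an exact measurable transport `f` has `BiLip f = ∞`, i.e.
no `M` is both a Lipschitz and an antilipschitz constant of `f`.  (`d_𝒵 ≠ d_𝒳` is allowed, as in
the paper.) -/
theorem CornishEtAl2020_thm_2_1_exact (dZ dX : ℕ)
    (P_Z : Measure (EuclideanSpace ℝ (Fin dZ))) [IsProbabilityMeasure P_Z]
    (P_X : Measure (EuclideanSpace ℝ (Fin dX))) [IsProbabilityMeasure P_X]
    (hsupp : IsEmpty (P_Z.support ≃ₜ P_X.support))
    (f : EuclideanSpace ℝ (Fin dZ) → EuclideanSpace ℝ (Fin dX)) (hf : P_Z.map f = P_X) :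
    ∀ M : ℝ≥0, ¬ (LipschitzWith M f ∧ AntilipschitzWith M f) :=
  fun _ hM => map_ne_of_isEmpty_homeomorph_support hsupp hM.1 hM.2 hf

end BiLipschitz

end Literature.Probability.TransportMaps
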